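import Mathlib.AlgebraicGeometry.ResidueField
import Mathlib.AlgebraicGeometry.AffineSpace
import Mathlib.AlgebraicGeometry.Morphisms.Proper
import Mathlib.AlgebraicGeometry.Pullbacks
import Mathlib.Analysis.Complex.Basic
import Mathlib.Analysis.Normed.Field.Basic
import Mathlib.Topology.ContinuousMap.Basic
import Literature.AlgebraicGeometry.Motives.Varieties
import HarnessLib

-- provenance: harness21/H21/H21/Prelude/MotiveAbstract/AlgPoints.lean @ c3fce92 (interim HEAD d8f2665); M5 mechanical rewrite
/-!
# `L`-valued points of a `k`-scheme with the strong topology (trunk T-MOTIVE, prelude C2)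

For a `k`-scheme `X : Literature.SchemeOver k` (Mathlib's `Over (Spec k)`) and a field `L` which is a
`k`-algebra, `Literature.AlgPoints X L` is the set `X(L)` of `L`-valued points of `X` over `k`, realised
as the type of morphisms `Spec L ⟶ X` in `Over (Spec k)`. This is ONE type serving schemes and
abelian varieties alike: for a group object `A` in `Over (Spec k)`, Mathlib's (scoped)
`Hom.commGroup` puts the group structure on the very same type.

When `L` carries a topology (`ℂ`, `ℝ`, `ℚ_p`), `X(L)` gets the *strong* (analytic) topology: the
coarsest topology for which, for every open `U ⊆ X` and every regular function `f ∈ Γ(X, U)`, the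
set `U(L)` is open and `P ↦ f(P) : U(L) → L` is continuous (Mumford, *The Red Book of Varieties and
Schemes*, I.10; Serre, *GAGA*, §2; for `L = ℂ` this is the topology of the associated complex
analytic space). The *instance* `AlgPoints.instTopologicalSpace` is defined for an arbitrary
`[TopologicalSpace L]`, but the named properties (compatibility with products, Hausdorffness for
separated `X`, `𝔸ⁿ(L) ≃ₜ Lⁿ`) hold, and are stated, only for Hausdorff topological fields
(`[IsTopologicalDivisionRing L] [T2Space L]`), as in all the sources.

## Main definitions

* `Literature.AlgPoints X L := specOver k L ⟶ X`, with `AlgPoints.mk`, `.toSpecHom`, `.pt` (the image of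
  the unique point of `Spec L`), `.resHom : κ(pt P) ⟶ L` (both via Mathlib
  `Scheme.SpecToEquivOfField`), `.eval` (value of a regular function at `P`, via Mathlib
  `Scheme.evaluation`).
* `AlgPoints.instTopologicalSpace`: the strong topology, generated by the sets
  `AlgPoints.basicSet U f V = {P ∈ U(L) | f(P) ∈ V}` for `V ⊆ L` open.
* `AlgPoints.map φ : X(L) → Y(L)` (post-composition), `AlgPoints.mapContinuous φ : C(X(L), Y(L))`,
  `AlgPoints.prodEquiv : (X ×ₖ Y)(L) ≃ X(L) × Y(L)`.
* Galois action: `AlgPoints.specMap σ : Spec L ⟶ Spec L` over `k` for `σ : L ≃ₐ[k] L`, and the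
  LEFT action `σ • P := specMap σ ≫ P` of `L ≃ₐ[k] L` on `X(L)` (`AlgPoints.instMulActionAlgEquiv`).
  Convention: on affine coordinates, `σ • P` has coordinates `σ (xᵢ(P))`.
* `Literature.ComplexPoints X := AlgPoints X ℂ` (universe `0`).

## Design notes

* The universe of `L` equals that of `k` (forced by `Spec`); this pins Betti cohomology of
  `ComplexPoints X` to `k : Type`.
* `[TopologicalSpace L]` is assumed only where it is used; the point-set API is topology-free.
  The topology instance needs only `[TopologicalSpace L]`; every theorem asserting a property of
  it that uses continuity of `+`, `*`, `⁻¹` on `L` and separation (products, Hausdorff, `𝔸ⁿ`)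
  assumes a Hausdorff topological field `[IsTopologicalDivisionRing L] [T2Space L]`. Without
  these the statements are false: for `L` with the cofinite topology polynomial maps `L² → L`
  are not continuous; for `L` indiscrete, `𝔸¹(L)` still has the nonempty proper open subset
  `D(x)(L) = {a ≠ 0}` while `L` has none, and `(𝔸¹ ×ₖ 𝔸¹)(k)` (Zariski topology on `k²`) is
  finer than `𝔸¹(k) × 𝔸¹(k)` (product of cofinite topologies); and `f = 1/x` on `D(x)` forces
  continuity of inversion.
* `t2Space_algPoints`, `compactSpace_algPoints_of_isProper`, `locallyCompactSpace_algPoints` are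
  instance-shaped facts kept as `theorem`s because their proofs are `sorry`; a later pass with
  real proofs should upgrade them to instances.
* Mathlib has no topology on `L`-points of a scheme (searched `SpecToEquivOfField`, `AffineSpace`,
  `pointsEquiv`: only the bijections `Scheme.SpecToEquivOfField` and, for affine space,
  `AffineSpace.homOverEquiv`, which we reuse).
* `AlgPoints.mapContinuous` relies on the theorem `AlgPoints.continuous_map`.

## References

* D. Mumford, *The Red Book of Varieties and Schemes*, I.10.
* J.-P. Serre, *Géométrie algébrique et géométrie analytique* (GAGA), Ann. Inst. Fourier 6
  (1956), §2.
* R. Hartshorne, *Algebraic Geometry*, II.2–II.4, Appendix B.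
* B. Conrad, *Weil and Grothendieck approaches to adelic points*, Enseign. Math. 58 (2012), §2–§5
  (topology on `X(L)` for topological fields `L`; Hausdorff iff separated, compact if proper over a
  local field).
-/

universe u

open CategoryTheory AlgebraicGeometry MonoidalCategory Topology

noncomputable section

namespace Literature.AlgebraicGeometry.Motives

variable {k : Type u} [Field k]

/-- The `L`-valued points `X(L)` of a `k`-scheme `X` over `k`, for a field `L` which is a
`k`-algebra: morphisms `Spec L ⟶ X` in `Over (Spec k)` (Hartshorne, *Algebraic Geometry*, II.2,
Ex. 2.7; Mumford, *Red Book*, II.4). [folklore] -/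
abbrev AlgPoints (X : SchemeOver k) (L : Type u) [Field L] [Algebra k L] : Type u :=
  specOver k L ⟶ X

namespace AlgPoints

variable {X Y Z : SchemeOver k} {L : Type u} [Field L] [Algebra k L]

/-- Constructor for `L`-points: a morphism `P : Spec L ⟶ X` of schemes compatible with the structure
maps to `Spec k` (this is `Over.homMk`; Hartshorne II Ex. 2.7). [folklore] -/
abbrev mk (P : Spec (.of L) ⟶ X.left)
    (w : P ≫ X.hom = Spec.map (CommRingCat.ofHom (algebraMap k L))) : AlgPoints X L :=
  Over.homMk P w

/-- The underlying morphism of schemes `Spec L ⟶ X` of an `L`-point (Hartshorne II Ex. 2.7). [folklore] -/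
abbrev toSpecHom (P : AlgPoints X L) : Spec (.of L) ⟶ X.left := P.left

/-- The point of the scheme `X` underlying an `L`-point `P`: the image of the unique point of
`Spec L` (first component of Mathlib `Scheme.SpecToEquivOfField`; Hartshorne II Ex. 2.7). [folklore] -/
def pt (P : AlgPoints X L) : X.left := (X.left.SpecToEquivOfField L P.left).1

/-- The embedding `κ(P.pt) ⟶ L` of the residue field at the underlying point of an `L`-point `P`
(second component of Mathlib `Scheme.SpecToEquivOfField`; Hartshorne II Ex. 2.7). [folklore] -/
def resHom (P : AlgPoints X L) : X.left.residueField P.pt ⟶ .of L :=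
  (X.left.SpecToEquivOfField L P.left).2

/-- The value `f(P) ∈ L` of a regular function `f ∈ Γ(X, U)` at an `L`-point `P` lying in `U`:
evaluate `f` in the residue field `κ(P.pt)` (Mathlib `Scheme.evaluation`) and push along
`P.resHom : κ(P.pt) ⟶ L` (Mumford, *Red Book*, I.10; Hartshorne II Ex. 2.7). [folklore] -/
def eval (P : AlgPoints X L) (U : X.left.Opens) (h : P.pt ∈ U) (f : Γ(X.left, U)) : L :=
  P.resHom (X.left.evaluation U P.pt h f)

/-- The sub-basic set `{P ∈ U(L) | f(P) ∈ V}` of `X(L)` attached to an open `U ⊆ X`, a regular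
function `f ∈ Γ(X, U)` and a subset `V ⊆ L` (Mumford, *Red Book*, I.10). [folklore] -/
def basicSet (U : X.left.Opens) (f : Γ(X.left, U)) (V : Set L) : Set (AlgPoints X L) :=
  {P | ∃ h : P.pt ∈ U, P.eval U h f ∈ V}

/-- The *strong* (analytic) topology on `X(L)` for a topological field `L`: the topology
generated by the sets `basicSet U f V` with `V ⊆ L` open, i.e. the coarsest topology making every
`U(L)` open and every regular function `U(L) → L` continuous (Mumford, *Red Book*, I.10;
Serre, GAGA §2; Conrad, *Weil and Grothendieck approaches to adelic points*, Prop. 2.1).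
The definition makes sense for any `[TopologicalSpace L]`, but its expected properties
(`isHomeomorph_prodEquiv`, `t2Space_algPoints`, `nonempty_algPoints_affineSpace_homeomorph`)
hold only when `L` is a Hausdorff topological field
(`[IsTopologicalDivisionRing L] [T2Space L]`). [folklore] -/
instance instTopologicalSpace [TopologicalSpace L] : TopologicalSpace (AlgPoints X L) :=
  TopologicalSpace.generateFrom
    {S | ∃ (U : X.left.Opens) (f : Γ(X.left, U)) (V : Set L), IsOpen V ∧ S = basicSet U f V}

/-- A basic set with `V` open is open in the strong topology (by definition; Mumford, *Red Book*,
I.10). [folklore] -/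
theorem isOpen_basicSet [TopologicalSpace L] (U : X.left.Opens) (f : Γ(X.left, U)) {V : Set L}
    (hV : IsOpen V) : IsOpen (basicSet U f V : Set (AlgPoints X L)) :=
  TopologicalSpace.isOpen_generateFrom_of_mem ⟨U, f, V, hV, rfl⟩

/-! ### Functoriality -/

/-- Functoriality of `L`-points in the `k`-scheme: `X(L) → Y(L)`, `P ↦ P ≫ φ`
(Hartshorne II Ex. 2.7). [folklore] -/
def map (φ : X ⟶ Y) (P : AlgPoints X L) : AlgPoints Y L := P ≫ φ

/-- `map φ P` is post-composition with `φ` (Hartshorne II Ex. 2.7). [folklore] -/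
theorem map_apply (φ : X ⟶ Y) (P : AlgPoints X L) : map φ P = P ≫ φ := rfl

/-- `map` of the identity fixes every point (category axioms; Hartshorne II Ex. 2.7). [folklore] -/
@[simp]
theorem map_id_apply (P : AlgPoints X L) : map (𝟙 X) P = P := by
  simp [map]

/-- `map` of the identity is the identity (category axioms; Hartshorne II Ex. 2.7). [folklore] -/
theorem map_id : map (𝟙 X) = (id : AlgPoints X L → AlgPoints X L) :=
  funext map_id_apply

/-- `map` of a composite, applied to a point (category axioms; Hartshorne II Ex. 2.7). [folklore] -/
@[simp]
theorem map_comp_apply (φ : X ⟶ Y) (ψ : Y ⟶ Z) (P : AlgPoints X L) :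
    map (φ ≫ ψ) P = map ψ (map φ P) := by
  simp [map]

/-- `map` is compatible with composition (category axioms; Hartshorne II Ex. 2.7). [folklore] -/
theorem map_comp (φ : X ⟶ Y) (ψ : Y ⟶ Z) :
    map (L := L) (φ ≫ ψ) = map ψ ∘ map φ :=
  funext (map_comp_apply φ ψ)

/-- The underlying point of `map φ P` is the image under `φ` of the underlying point of `P`
(Hartshorne II Ex. 2.7). [folklore] -/
@[simp]
theorem pt_map (φ : X ⟶ Y) (P : AlgPoints X L) : (map φ P).pt = φ.left (P.pt) := rfl

/-- The residue-field embedding of `map φ P` is the residue field map of `φ` followed by that of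
`P` (Mathlib `Scheme.descResidueField_stalkClosedPointTo_comp`). [folklore] -/
theorem resHom_map (φ : X ⟶ Y) (P : AlgPoints X L) :
    (map φ P).resHom = φ.left.residueFieldMap P.pt ≫ P.resHom :=
  Scheme.descResidueField_stalkClosedPointTo_comp φ.left P.left

/-- Evaluation is natural: `f(φ(P)) = (φ^* f)(P)` (Mathlib `Scheme.evaluation_naturality_apply`). [folklore] -/
theorem eval_map (φ : X ⟶ Y) (P : AlgPoints X L) (U : Y.left.Opens) (h : (map φ P).pt ∈ U)
    (f : Γ(Y.left, U)) :
    (map φ P).eval U h f = P.eval (φ.left ⁻¹ᵁ U) h (φ.left.app U f) := by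
  simp only [eval, resHom_map]
  change (φ.left.residueFieldMap P.pt ≫ P.resHom) (Y.left.evaluation U (φ.left P.pt) h f) = _
  rw [CategoryTheory.comp_apply, Scheme.evaluation_naturality_apply]

/-- The preimage of a basic set under `map φ` is a basic set (Hartshorne II Ex. 2.7; Mumford,
*Red Book*, I.10). [folklore] -/
theorem preimage_map_basicSet (φ : X ⟶ Y) (U : Y.left.Opens) (f : Γ(Y.left, U)) (V : Set L) :
    map φ ⁻¹' (basicSet U f V : Set (AlgPoints Y L)) =
      basicSet (φ.left ⁻¹ᵁ U) (φ.left.app U f) V := by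
  ext P
  simp only [Set.mem_preimage, basicSet, Set.mem_setOf_eq, eval_map]
  rfl

/-- `map φ : X(L) → Y(L)` is continuous for the strong topologies (regular functions pull back to
regular functions; Mumford, *Red Book*, I.10). [folklore] -/
theorem continuous_map [TopologicalSpace L] (φ : X ⟶ Y) :
    Continuous (map φ : AlgPoints X L → AlgPoints Y L) := by
  refine continuous_generateFrom_iff.mpr ?_
  rintro _ ⟨U, f, V, hV, rfl⟩
  rw [preimage_map_basicSet]
  exact isOpen_basicSet _ _ hV

/-- `map φ` as a bundled continuous map `C(X(L), Y(L))` (relies on `continuous_map`); this is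
what singular (Betti) cohomology of `X(ℂ)` is functorial in (Mumford, *Red Book*, I.10). [folklore] -/
def mapContinuous [TopologicalSpace L] (φ : X ⟶ Y) : C(AlgPoints X L, AlgPoints Y L) :=
  ⟨map φ, continuous_map φ⟩

/-- `mapContinuous φ` is `map φ` as a function (Mumford, *Red Book*, I.10). [folklore] -/
@[simp]
theorem mapContinuous_apply [TopologicalSpace L] (φ : X ⟶ Y) (P : AlgPoints X L) :
    mapContinuous φ P = map φ P := rfl

/-! ### Products -/

/-- `L`-points of a fibre product over `k` are pairs of `L`-points:
`(X ×ₖ Y)(L) ≃ X(L) × Y(L)`, by the universal property of the product in the cartesian monoidal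
category `Over (Spec k)` (Hartshorne II.3, Thm. 3.3). [folklore] -/
def prodEquiv : AlgPoints (X ⊗ Y) L ≃ AlgPoints X L × AlgPoints Y L where
  toFun P := (P ≫ CartesianMonoidalCategory.fst X Y, P ≫ CartesianMonoidalCategory.snd X Y)
  invFun Q := CartesianMonoidalCategory.lift Q.1 Q.2
  left_inv P := by simp
  right_inv Q := by simp

/-- The first component of `prodEquiv` is `map` of the first projection (Hartshorne II.3,
Thm. 3.3). [folklore] -/
@[simp]
theorem prodEquiv_apply_fst (P : AlgPoints (X ⊗ Y) L) :
    (prodEquiv P).1 = map (CartesianMonoidalCategory.fst X Y) P := rfl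

/-- The second component of `prodEquiv` is `map` of the second projection (Hartshorne II.3,
Thm. 3.3). [folklore] -/
@[simp]
theorem prodEquiv_apply_snd (P : AlgPoints (X ⊗ Y) L) :
    (prodEquiv P).2 = map (CartesianMonoidalCategory.snd X Y) P := rfl

/-- The inverse of `prodEquiv` is the pairing `CartesianMonoidalCategory.lift` (Hartshorne II.3,
Thm. 3.3). [folklore] -/
@[simp]
theorem prodEquiv_symm_apply (P : AlgPoints X L) (Q : AlgPoints Y L) :
    prodEquiv.symm (P, Q) = CartesianMonoidalCategory.lift P Q := rfl

/-- The strong topology of a fibre product is the product topology: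
`(X ×ₖ Y)(L) ≃ₜ X(L) × Y(L)` for a topological field `L` (Mumford, *Red Book*, I.10, properties
of the complex topology; Conrad, *Weil and Grothendieck approaches to adelic points*, Prop. 2.1 /
Ex. 2.2). `L` must be a Hausdorff topological field (`[IsTopologicalDivisionRing L]
[T2Space L]`): continuity of `+`, `*`, `⁻¹` makes functions such as `f ⊗ g` continuous on
`X(L) × Y(L)`, and without Hausdorffness the Zariski-open sets `U(L)` of `X ×ₖ Y` are open in
`(X ×ₖ Y)(L)` but not in `X(L) × Y(L)`. [cite: ConradAdelicPoints2012, Prop. 2.1] -/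
def isHomeomorph_prodEquiv : Prop :=
  ∀ [TopologicalSpace L] [IsTopologicalDivisionRing L] [T2Space L],
    IsHomeomorph (prodEquiv : AlgPoints (X ⊗ Y) L ≃ AlgPoints X L × AlgPoints Y L)

/-! ### Galois action -/

/-- The `k`-automorphism of `Spec L` over `Spec k` induced by `σ : L ≃ₐ[k] L`, namely
`Spec (σ : L →+* L)` (Hartshorne II.2, II Ex. 4.7). [folklore] -/
def specMap (σ : L ≃ₐ[k] L) : specOver k L ⟶ specOver k L :=
  Over.homMk (Spec.map (CommRingCat.ofHom (σ : L →+* L))) (by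
    change Spec.map _ ≫ Spec.map _ = Spec.map _
    rw [← Spec.map_comp, ← CommRingCat.ofHom_comp]
    congr 2
    exact RingHom.ext σ.commutes)

/-- The underlying scheme morphism of `specMap σ` is `Spec σ` (Hartshorne II.2). [folklore] -/
@[simp]
theorem specMap_left (σ : L ≃ₐ[k] L) :
    (specMap σ).left = Spec.map (CommRingCat.ofHom (σ : L →+* L)) := rfl

/-- `specMap` of the identity automorphism is the identity (functoriality of `Spec`;
Hartshorne II.2, Prop. 2.3). [folklore] -/
@[simp]
theorem specMap_one : specMap (1 : L ≃ₐ[k] L) = 𝟙 _ := by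
  ext : 1
  have h1 : ((1 : L ≃ₐ[k] L) : L →+* L) = RingHom.id L := RingHom.ext fun _ => rfl
  simp only [specMap, Over.homMk_left, Over.id_left, h1]
  change Spec.map (𝟙 (CommRingCat.of L)) = _
  rw [Spec.map_id]
  rfl

/-- `specMap` turns products into compositions *in the same order*: `Spec` is contravariant and
`σ * τ = σ ∘ τ`, so the two reversals cancel (functoriality of `Spec`; Hartshorne II.2,
Prop. 2.3). [folklore] -/
theorem specMap_mul (σ τ : L ≃ₐ[k] L) : specMap (σ * τ) = specMap σ ≫ specMap τ := by
  ext : 1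
  have h1 : ((σ * τ : L ≃ₐ[k] L) : L →+* L) = (σ : L →+* L).comp τ := RingHom.ext fun _ => rfl
  simp only [specMap, Over.homMk_left, Over.comp_left, h1, CommRingCat.ofHom_comp, Spec.map_comp]
  rfl

/-- The LEFT action of `Aut(L/k)` on `X(L)`: `σ • P := specMap σ ≫ P`. On an affine chart with
coordinates `x₁, …, xₙ ∈ Γ(X, U)` defined over `k`, the point `σ • P` has coordinates
`σ (xᵢ(P))`, i.e. this is the usual action of Galois on coordinates (Hartshorne II Ex. 4.7;
Silverman, *The Arithmetic of Elliptic Curves*, I.2). This convention is fixed here for all of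
H21. [folklore] -/
instance instMulActionAlgEquiv : MulAction (L ≃ₐ[k] L) (AlgPoints X L) where
  smul σ P := specMap σ ≫ P
  one_smul P := by change specMap 1 ≫ P = P; rw [specMap_one]; simp
  mul_smul σ τ P := by
    change specMap (σ * τ) ≫ P = specMap σ ≫ (specMap τ ≫ P); rw [specMap_mul]; simp

/-- Definition of the Galois action: `σ • P = specMap σ ≫ P` (LEFT action; Hartshorne II
Ex. 4.7). [folklore] -/
theorem smul_def (σ : L ≃ₐ[k] L) (P : AlgPoints X L) : σ • P = specMap σ ≫ P := rfl

/-- `map φ : X(L) → Y(L)` is `Aut(L/k)`-equivariant (associativity of composition; Hartshorne II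
Ex. 4.7). [folklore] -/
@[simp]
theorem map_smul (φ : X ⟶ Y) (σ : L ≃ₐ[k] L) (P : AlgPoints X L) :
    map φ (σ • P) = σ • map φ P := by
  simp [smul_def, map]

/-- The underlying scheme morphism of `σ • P` is `Spec σ ≫ P` (Hartshorne II Ex. 4.7). [folklore] -/
theorem smul_left (σ : L ≃ₐ[k] L) (P : AlgPoints X L) :
    (σ • P).left = Spec.map (CommRingCat.ofHom (σ : L →+* L)) ≫ P.left := rfl

/-- Under Mathlib `Scheme.SpecToEquivOfField`, `σ • P` corresponds to the same point of `X` with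
residue-field embedding `κ(P.pt) ⟶ L` twisted by `σ` (Hartshorne II Ex. 4.7). [folklore] -/
theorem specToEquivOfField_smul (σ : L ≃ₐ[k] L) (P : AlgPoints X L) :
    X.left.SpecToEquivOfField L (σ • P).left =
      ⟨P.pt, P.resHom ≫ CommRingCat.ofHom (σ : L →+* L)⟩ := by
  apply (X.left.SpecToEquivOfField L).symm.injective
  rw [Equiv.symm_apply_apply, smul_left]
  simp only [Scheme.SpecToEquivOfField_symm_apply, Spec.map_comp, Category.assoc]
  congr 1
  exact ((X.left.SpecToEquivOfField L).symm_apply_apply P.left).symm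

/-- The Galois action does not move the underlying point of `X` (Hartshorne II Ex. 4.7). [folklore] -/
@[simp]
theorem pt_smul (σ : L ≃ₐ[k] L) (P : AlgPoints X L) : (σ • P).pt = P.pt :=
  (Scheme.SpecToEquivOfField_eq_iff.mp (specToEquivOfField_smul σ P)).1

/-- Transport of `Scheme.evaluation` along an equality of points (helper; Mathlib
`Scheme.residueFieldCongr`). [folklore] -/
private theorem residueFieldCongr_evaluation {X : Scheme.{u}} (U : X.Opens) {x y : X}
    (e : x = y) (h : x ∈ U) (f : Γ(X, U)) :
    (X.residueFieldCongr e).hom (X.evaluation U x h f) = X.evaluation U y (e ▸ h) f := by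
  subst e
  rfl

/-- On values of regular functions the Galois action is `σ`: `f(σ • P) = σ (f(P))` for `f`
defined over `k` (Hartshorne II Ex. 4.7; Silverman, *AEC*, I.2). [folklore] -/
theorem eval_smul (σ : L ≃ₐ[k] L) (P : AlgPoints X L) (U : X.left.Opens) (h : (σ • P).pt ∈ U)
    (f : Γ(X.left, U)) :
    (σ • P).eval U h f = σ (P.eval U ((pt_smul σ P) ▸ h) f) := by
  obtain ⟨e, he⟩ := Scheme.SpecToEquivOfField_eq_iff.mp (specToEquivOfField_smul σ P)
  change (X.left.SpecToEquivOfField L (σ • P).left).2 _ = _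
  rw [he, CategoryTheory.comp_apply, CategoryTheory.comp_apply]
  change σ (P.resHom _) = σ (P.resHom _)
  congr 2
  exact residueFieldCongr_evaluation U e h f

/-- The preimage of a basic set under `P ↦ σ • P` is the basic set for `σ ⁻¹' V`
(Hartshorne II Ex. 4.7). [folklore] -/
theorem preimage_smul_basicSet (σ : L ≃ₐ[k] L) (U : X.left.Opens) (f : Γ(X.left, U))
    (V : Set L) :
    (fun P : AlgPoints X L => σ • P) ⁻¹' basicSet U f V = basicSet U f (σ ⁻¹' V) := by
  ext P
  simp only [Set.mem_preimage, basicSet, Set.mem_setOf_eq, eval_smul]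
  constructor
  · rintro ⟨h, hV⟩
    exact ⟨(pt_smul σ P) ▸ h, hV⟩
  · rintro ⟨h, hV⟩
    exact ⟨(pt_smul σ P).symm ▸ h, hV⟩

/-- If `σ : L ≃ₐ[k] L` is continuous, then `P ↦ σ • P` is continuous on `X(L)` for the strong
topology (on coordinates it is `σ`; Mumford, *Red Book*, I.10). E.g. complex conjugation acting on
`X(ℂ)` for `k ⊆ ℝ`. [folklore] -/
theorem continuous_smul_algEquiv [TopologicalSpace L] (σ : L ≃ₐ[k] L) (hσ : Continuous σ) :
    Continuous (fun P : AlgPoints X L => σ • P) := by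
  refine continuous_generateFrom_iff.mpr ?_
  rintro _ ⟨U, f, V, hV, rfl⟩
  rw [preimage_smul_basicSet]
  exact isOpen_basicSet _ _ (hV.preimage hσ)

end AlgPoints

/-! ### Topological properties of the strong topology

The three facts `t2Space_algPoints`, `compactSpace_algPoints_of_isProper`,
`locallyCompactSpace_algPoints` are instance-shaped; they are `theorem`s here only because their
proofs are `sorry` (H21 policy). Upgrade them to `instance`s once proved. -/

section Topology

variable (X : SchemeOver k) (L : Type u)

/-- If `L` is a Hausdorff topological field and `X` is separated over `k`, then `X(L)` is
Hausdorff: the diagonal `X(L) → (X ×ₖ X)(L) ≃ₜ X(L) × X(L)` is a closed immersion on points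
(Mumford, *Red Book*, I.10, Thm. 1 for `ℂ`; Conrad, *Weil and Grothendieck approaches to
adelic points*, Prop. 2.1). Requires `L` to be a Hausdorff topological field
(`[IsTopologicalDivisionRing L] [T2Space L]`; the proof goes through `isHomeomorph_prodEquiv`). [cite: MumfordRedBook1999, I.10 Thm. 1; Conrad Prop. 2.1] -/
def t2Space_algPoints : Prop :=
  ∀ [Field L] [Algebra k L] [TopologicalSpace L] [IsTopologicalDivisionRing L] [T2Space L] [IsSeparated X.hom],
    T2Space (AlgPoints X L)

/-- If `L` is a non-trivially normed, locally compact field (`ℝ`, `ℂ`, finite extensions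
of `ℚ_p`; such a field is automatically complete) and `X` is proper over `k`, then `X(L)` is
compact (Mumford, *Red Book*, I.10, Thm. 2 for `ℂ`; Serre, GAGA §2, Prop. 6; Conrad, *loc. cit.*,
Prop. 2.1 and §5). [cite: MumfordRedBook1999, I.10 Thm. 2; Conrad Prop. 2.1 and §5] -/
def compactSpace_algPoints_of_isProper : Prop :=
  ∀ [NontriviallyNormedField L] [Algebra k L] [LocallyCompactSpace L] [IsProper X.hom],
    CompactSpace (AlgPoints X L)

/-- If `L` is a non-trivially normed, locally compact field and `X` is separated and of
finite type over `k`, then `X(L)` is locally compact: locally it is a closed subspace of `Lⁿ`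
(Mumford, *Red Book*, I.10; Serre, GAGA §2; Conrad, *loc. cit.*, Prop. 2.1). The hypothesis
`[IsSeparated X.hom]` is deliberate (it is the setting of the sources, giving a Hausdorff locally
compact space); for Mathlib's non-Hausdorff `LocallyCompactSpace` it could be dropped. [cite: ConradAdelicPoints2012, Prop. 2.1] -/
def locallyCompactSpace_algPoints : Prop :=
  ∀ [NontriviallyNormedField L] [Algebra k L] [LocallyCompactSpace L] [IsSeparated X.hom] [LocallyOfFiniteType X.hom],
    LocallyCompactSpace (AlgPoints X L)

/-- The strong topology on the `L`-points of affine space `𝔸^σ_k`, for a Hausdorff topological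
field `L`, is that of `σ → L`: there is a homeomorphism `𝔸^σ(L) ≃ₜ L^σ` (the underlying bijection
is Mathlib `AffineSpace.homOverEquiv`; Mumford, *Red Book*, I.10; Serre, GAGA §2, the case
`X = 𝔸ⁿ`). `[IsTopologicalDivisionRing L] [T2Space L]` is essential: polynomial functions and
`1/x` on `D(x)` must be continuous, and `D(x)(L) = {a ≠ 0}` must be open in `L`.
(Name as planned in the outline; Mathlib order would be
`nonempty_homeomorph_algPoints_affineSpace`.) [cite: MumfordRedBook1999, I.10 (the case X = 𝔸ⁿ)] -/
def nonempty_algPoints_affineSpace_homeomorph : Prop :=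
  ∀ [Field L] [Algebra k L] [TopologicalSpace L] [IsTopologicalDivisionRing L] [T2Space L] (σ : Type u) [Finite σ],
    Nonempty (AlgPoints (Over.mk (𝔸(σ; Spec (.of k)) ↘ Spec (.of k))) L ≃ₜ (σ → L))

end Topology

/-- The complex points `X(ℂ)` of a scheme over a subfield `k ⊆ ℂ` (any `k : Type` with
`[Algebra k ℂ]`), with the analytic topology `AlgPoints.instTopologicalSpace`
(Serre, GAGA §2; Mumford, *Red Book*, I.10). Universe `0` is forced by `ℂ : Type`. [folklore] -/
abbrev ComplexPoints {k : Type} [Field k] [Algebra k ℂ] (X : SchemeOver k) : Type :=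
  AlgPoints X ℂ

end Literature.AlgebraicGeometry.Motives
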